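import Summits.ABC.IUTFork.LDHGenuinePerImageUnconditionalDegreeThirty
import Summits.ABC.IUTFork.LDHWitness
import Literature.IUT.LogVolume.Corollary22RatPointDictionary
import Literature.IUT.LogVolume.Corollary22PartIIUpTo
import HarnessLib

/-!
# The fork at [IUTchIII] Corollary 3.12, L-DH level, READING (P): the two-layer unconditional per-image test AT A RATIONAL POINT —
# the dictionary value of its `3`- and `5`-terms, and a closed form ready for the row files (proof-only)

Record-only PROOF file (D-0012) of the abc-iut cell (branch C certificate seat abc-iut-C-cert-1, gen 6; row «C:ZETA-CUT», part 3: the `d = 1` interface of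
`Cor22.cor312PerImageOf_of_le_degree_thirty`, p478742). TAKES NO SIDE on [IUTchIII] Cor. 3.12. At a `ℚ`-rational point `λ = q` with
`j(q) = N / ∏_{p ∈ I} p^{e_p}` (abc-iut-c312-d1's dictionary `Corollary22RatPointDictionary`, p462751) the new terms of the two-layer test are DICTIONARY VALUES:

* `Cor22.sum_log_absNorm_placesOver_sdiff_badPlacesAvoid_ratPoint_of_not_mem` — for a prime `p ∉ I` (not a pole of `j(q)`):
  `Σ_{v ∈ placesOver ℚ p \ 𝕍^bad_mod} log N(v) = log p` (the unique place of `ℚ` over `p` is good and has norm `p`);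
* `Cor22.sum_log_absNorm_placesOver_sdiff_badPlacesAvoid_nonneg` — the sum is `≥ 0` in any case (drop an unfavourable term);
* **`Cor22.cor312PerImageOf_ratPoint_of_le_thirty`** — `q ∈ ℚ ∖ {0,1}`, prime `l ≥ 7`, reals `G₃ ≤ Σ_{v|3 good} log N(v)`, `G₅ ≤ Σ_{v|5 good} log N(v)`
  (so `G₃ ∈ {0, log 3}`, `G₅ ∈ {0, log 5}` by the two lemmas above): if
  `((l+1)/24 − 1/(2l))·log q^{∤2l}(q) ≤ ((l+5)/4 − 1)·((1 − 1/l)·log 𝔣^{∤2l}(q) + (1 − 1/(l−1))·log l + G₃/2 + 3·G₅/4) + ((l+5)/4)·log π`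
  then `T.Cor312PerImageOf` at EVERY genuine Θ-volume datum `T` of `(q, l)` — NO hypothesis beyond the arithmetic of the row (abc-iut-s2-p4's p471287 test is
  the case `G₃ = G₅ = 0`). This is the form the row files (abc-iut-c312-d1 / s2-p4 / W-num-2 template: dictionary sums + one `decide`) consume.

DESK (this seat's HOME/staging/C/cert-1/g6/PERIMAGE-ZETA30-FLIPS.tsv, sibling of abc-iut-c312-d1's PERIMAGE-ZETA-MARGINS.tsv): 22 of the 1,305 (triple, l) rows of the
N3 Szpiro-bad scan that fail the one-layer test pass this one (3 triples). desk ≠ kernel; the rows are not asserted here. HONEST SCOPE: statements about the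
cell's typed objects; nothing asserts that data exist, Cor. 3.12 in general or in print, or abc. proved-as-typed ≠ in print.
[cite: Mochizuki2012, IUTchIII Cor. 3.12 p. 173–174; IUTchIV Thm. 1.10 p. 22, Step (ii) p. 24; Cor. 2.2 (ii) proof (P5) p. 46] [cite: MochizukiGenEll2010, Def. 3.3 p. 12]
[cite: SilvermanAEC2009, Cor. III.8.1.1] [claim: Mochizuki2012, status: disputed] for every IUT quotation. PROOF-ONLY: no definitions, no new `Prop`.
-/

noncomputable section

open NumberField IsDedekindDomain Ideal Module

namespace Literature.IUT.LogVolume.Cor22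

open Literature.NumberTheory.DiophantineGeometry Literature.NumberTheory.DiophantineGeometry.GenEll Summit.ABC.IUTFork
open Literature.IUT.HodgeTheaters Literature.NumberTheory.DiophantineGeometry.UniformABCConjecture Rat.HeightOneSpectrum

/-! ## 1. The dictionary value of the good-place sums at a rational point -/

open scoped Classical in
/-- **`Σ_{v ∈ placesOver ℚ p \ 𝕍^bad_mod} log N(v) = log p` when `p` is not a pole of `j(q)`** (`p ∉ I` for `j(q) = N/∏_{p∈I} p^{e_p}`, `N ≠ 0`): the
unique place of `ℚ` over `p` (`ValLine.placesOver_subsingleton_of_finrank_eq_one`) is not bad (abc-iut-c312-d1's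
`natGenerator_mem_of_mem_badPlacesAvoid_ratPoint`) and has norm `p`. [cite: MochizukiGenEll2010, Def. 3.3 p. 12]
[cite: Mochizuki2012, IUTchIV Cor 2.2 (ii) proof (P5) p.46] [claim: Mochizuki2012, status: disputed] -/
theorem sum_log_absNorm_placesOver_sdiff_badPlacesAvoid_ratPoint_of_not_mem {q : ℚ} {N D : ℕ} {I : Finset ℕ} {e : ℕ → ℕ}
    (hI : ∀ p ∈ I, p.Prime) (hD : D = ∏ p ∈ I, p ^ e p) (hj : jInv q = (N : ℚ) / (D : ℚ)) (hN : N ≠ 0)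
    (S : Finset ℕ) {p : ℕ} (hp : p.Prime) (hpI : p ∉ I) :
    ∑ v ∈ placesOver (ratPoint q).F p \ badPlacesAvoid (ratPoint q) S, Real.log ((absNorm v.asIdeal : ℕ) : ℝ) = Real.log p := by
  haveI : Fact p.Prime := ⟨hp⟩
  -- work over `𝓞 ℚ` (`(ratPoint q).F` is `ℚ` by `rfl`)
  change ∑ v ∈ placesOver ℚ p \ badPlacesAvoid (ratPoint q) S, Real.log ((absNorm v.asIdeal : ℕ) : ℝ) = Real.log p
  obtain ⟨v₀, hv₀⟩ := placesOver_nonempty ℚ p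
  have hres : residueChar ℚ v₀ = p := (mem_placesOver_iff_residueChar v₀).1 hv₀
  have hmem : ((p : ℕ) : 𝓞 ℚ) ∈ v₀.asIdeal := (natCast_mem_asIdeal_iff_residueChar_eq v₀ hp).2 hres
  have hgen : natGenerator v₀ = p :=
    (Nat.prime_dvd_prime_iff_eq (prime_natGenerator v₀) hp).1 ((natCast_mem_asIdeal_iff v₀ p).1 hmem)
  have hnot : v₀ ∉ badPlacesAvoid (ratPoint q) S := fun h =>
    hpI (hgen ▸ (natGenerator_mem_of_mem_badPlacesAvoid_ratPoint hI hD hj hN S h).1)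
  have hset : placesOver ℚ p \ badPlacesAvoid (ratPoint q) S = {v₀} := by
    ext v
    constructor
    · intro hv
      rw [Finset.mem_singleton]
      exact congrArg Subtype.val
        (ValLine.placesOver_subsingleton_of_finrank_eq_one (Module.finrank_self ℚ) p ⟨v, (Finset.mem_sdiff.1 hv).1⟩ ⟨v₀, hv₀⟩)
    · intro hv
      rw [Finset.mem_singleton] at hv
      rw [hv]
      exact Finset.mem_sdiff.2 ⟨hv₀, hnot⟩
  rw [hset, Finset.sum_singleton]
  have hN0 : Ideal.absNorm v₀.asIdeal = p := by rw [absNorm_asIdeal_eq_natGenerator, hgen]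
  rw [hN0]

open scoped Classical in
/-- The good-place sum is nonnegative at any point and prime (each `N(v) ≥ 1`). [folklore] -/
theorem sum_log_absNorm_placesOver_sdiff_badPlacesAvoid_nonneg (P : NFPoint) (S : Finset ℕ) (p : ℕ) :
    0 ≤ ∑ v ∈ placesOver P.F p \ badPlacesAvoid P S, Real.log ((absNorm v.asIdeal : ℕ) : ℝ) := by
  refine Finset.sum_nonneg fun v _ => Real.log_nonneg ?_
  exact_mod_cast Nat.one_le_iff_ne_zero.mpr (by rw [Ne, Ideal.absNorm_eq_zero_iff]; exact v.ne_bot)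

/-! ## 2. The two-layer test at a rational point, closed form for the row files -/

open scoped Classical in
/-- **RATIONAL POINTS, TWO CYCLOTOMIC LAYERS, ROW FORM**: for `q ∈ ℚ ∖ {0, 1}`, a prime `l ≥ 7`, and reals `G₃ ≤ Σ_{v|3 good} log N(v)`,
`G₅ ≤ Σ_{v|5 good} log N(v)` (`= log 3` / `log 5` when `3` / `5` is not a pole of `j(q)` by §1, and `0` is always admissible): if
`((l+1)/24 − 1/(2l))·log q^{∤2l}(q) ≤ ((l+5)/4 − 1)·((1 − 1/l)·log 𝔣^{∤2l}(q) + (1 − 1/(l−1))·log l + G₃/2 + 3·G₅/4) + ((l+5)/4)·log π`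
then `T.Cor312PerImageOf` at EVERY genuine Θ-volume datum `T` of `(q, l)` — `Cor22.cor312PerImageOf_of_le_degree_thirty` at `d = d_mod = 1`, `log-diff = 0`.
[cite: Mochizuki2012, IUTchIII Cor. 3.12 p. 173–174] [cite: Mochizuki2012, IUTchIV Thm. 1.10 p. 22, Step (ii) p. 24, Step (v) p. 27–29]
[cite: SilvermanAEC2009, Cor. III.8.1.1] [claim: Mochizuki2012, status: disputed] -/
theorem cor312PerImageOf_ratPoint_of_le_thirty {q : ℚ} {l : ℕ} (hq0 : q ≠ 0) (hq1 : q ≠ 1) (hl : l.Prime) (h7 : 7 ≤ l)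
    {G₃ G₅ : ℝ}
    (hG₃ : G₃ ≤ ∑ v ∈ placesOver (ratPoint q).F 3 \ badPlacesAvoid (ratPoint q) {2, l}, Real.log ((absNorm v.asIdeal : ℕ) : ℝ))
    (hG₅ : G₅ ≤ ∑ v ∈ placesOver (ratPoint q).F 5 \ badPlacesAvoid (ratPoint q) {2, l}, Real.log ((absNorm v.asIdeal : ℕ) : ℝ))
    (h : (((l : ℝ) + 1) / 24 - 1 / (2 * l)) * logQAvoid (ratPoint q) {2, l} ≤
      (((l : ℝ) + 5) / 4 - 1) * ((1 - 1 / (l : ℝ)) * logCondAvoid (ratPoint q) {2, l}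
          + (1 - 1 / ((l : ℝ) - 1)) * Real.log l + G₃ / 2 + 3 * G₅ / 4)
        + ((l : ℝ) + 5) / 4 * Real.log Real.pi)
    (T : ThetaVolumeDatumAt (ratPoint q) l) : T.Cor312PerImageOf := by
  have hUP := ratPoint_mem_UPle_one hq0 hq1
  have hd1 : dmod (ratPoint q) = 1 := dmod_eq_one_of_degree_le_one (le_of_eq (degree_ratPoint _))
  have hdeg : ((ratPoint q).degree : ℝ) = 1 := by exact_mod_cast degree_ratPoint q
  have hld : (ratPoint q).logDiff = 0 := by
    rw [NFPoint.logDiff_eq_log_discr]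
    change ((Module.finrank ℚ ℚ : ℕ) : ℝ)⁻¹ * Real.log ((NumberField.discr ℚ).natAbs : ℕ) = 0
    rw [Rat.numberField_discr]
    simp
  have h7R : (7 : ℝ) ≤ (l : ℝ) := by exact_mod_cast h7
  refine cor312PerImageOf_of_le_degree_thirty hUP.1.1 hl h7 (by rw [hd1]; push_cast; linarith) ?_ T
  rw [hd1, hdeg, hld]
  push_cast
  -- the clamps open at `d = 1`, `l ≥ 7`
  have hm1 : max 0 (1 - (1 : ℝ) / ((l : ℝ) - 1)) = 1 - 1 / ((l : ℝ) - 1) := by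
    refine max_eq_right ?_
    have : (0 : ℝ) < (l : ℝ) - 1 := by linarith
    rw [sub_nonneg, div_le_one this]; linarith
  have hm3 : max 0 (1 - (1 : ℝ) / 2) = 1 / 2 := by norm_num
  have hm5 : max 0 (1 - (1 : ℝ) / 4) = 3 / 4 := by norm_num
  rw [hm1, hm3, hm5]
  simp only [inv_one, one_mul, zero_add]
  have hC : (0 : ℝ) ≤ ((l : ℝ) + 5) / 4 - 1 := by linarith
  have hmono : (((l : ℝ) + 5) / 4 - 1) * ((1 - 1 / (l : ℝ)) * logCondAvoid (ratPoint q) {2, l}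
          + (1 - 1 / ((l : ℝ) - 1)) * Real.log l + G₃ / 2 + 3 * G₅ / 4) ≤
      (((l : ℝ) + 5) / 4 - 1) * ((1 - 1 / (l : ℝ)) * logCondAvoid (ratPoint q) {2, l}
          + (1 - 1 / ((l : ℝ) - 1)) * Real.log l
          + 1 / 2 * ∑ v ∈ placesOver (ratPoint q).F 3 \ badPlacesAvoid (ratPoint q) {2, l}, Real.log ((absNorm v.asIdeal : ℕ) : ℝ)
          + 3 / 4 * ∑ v ∈ placesOver (ratPoint q).F 5 \ badPlacesAvoid (ratPoint q) {2, l}, Real.log ((absNorm v.asIdeal : ℕ) : ℝ)) :=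
    mul_le_mul_of_nonneg_left (by linarith) hC
  linarith [h, hmono]

end Literature.IUT.LogVolume.Cor22

end
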